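import Summits.CriticalPhenomena.PercolationContinuityZ3.Theorems.PercNearOneGluingNoHeavyLowerTailSahiCombTriWCorNonneg

/-!
# `TriWIneq` for the CO-ATOM family `P = {w | #wᶜ ≤ 1}` (the top and the `n` co-atoms), every cube of dimension `n ≥ 3`, every index cube

Support file of the one-cut programme (crux `NoHeavyLowerTail`, stmt-CriticalPhenomena-4575; cell `prim-masterthm`, seat P5 gen 24; memo
`FROM-prim-masterthm-p5-g24-SANDWICH.md` §7).  First member `j = 1` of the THRESHOLD family `P_j = {w | #wᶜ ≤ j}` (`j < n/2`), for which the memo conjectures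
(exhaustively verified for `n ≤ 5`, local search `n ≤ 8`: OUTER-LAYER KLEITMAN) that the antipodal correlation `Cor_P(A,B)` of `…TriWCorNonneg` is `≥ 0` on all pairs of
up-sets, so that the CONSTANT sandwich certificate applies.  Here `j = 1` is proved: with `x_i = [univ.erase i ∈ A] − [{i} ∈ A]` one has
`Cor_P(A,B) = (1−[∅∈A])(1−[∅∈B]) + Σ_i x_i y_i`, each of `x, y ∈ {−1,0,1}^n` has at most one `−1` and is `+1` elsewhere if it has one, whence `Σ_i x_i y_i ≥ −1` for `n ≥ 3`
(`FiveUpSet.sum_mul_ge_neg_one`).  Results: `FiveUpSet.coatomFamily`, `isUpperSet_coatomFamily`, `corP_coatomFamily_nonneg`,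
**`triW_nonneg_coatomFamily`** (a new unconditional stratum of `TriWIneq`, all `a`, all `n ≥ 3`; `n ≤ 2` is the punctured cube of `…TriWPunctured`).
HONEST LABEL: complete proofs, std axioms; the general threshold family `j ≥ 2` stays OPEN (conjecture OLK, memo §7). [this work]
-/

namespace Summit.CriticalPhenomena.PercolationContinuityZ3.Theorems

namespace FiveUpSet

open Finset

variable {β γ : Type} [DecidableEq β] [Fintype β] [DecidableEq γ] [Fintype γ]

/-! ### A sign-vector lemma -/

omit [DecidableEq β] [Fintype β] [DecidableEq γ] in
/-- If `x, y : γ → ℤ` take values in `{−1,0,1}`, each has at most one `−1`, and is `+1` away from its `−1` (if any), then `Σ_i x_i y_i ≥ −1` as soon as `#γ ≥ 3`. [this work] -/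
theorem sum_mul_ge_neg_one [DecidableEq γ] (hγ : 3 ≤ Fintype.card γ) (x y : γ → ℤ)
    (hx0 : ∀ i, x i = -1 ∨ x i = 0 ∨ x i = 1) (hy0 : ∀ i, y i = -1 ∨ y i = 0 ∨ y i = 1)
    (hx : ∀ i, x i = -1 → ∀ j, j ≠ i → x j = 1) (hy : ∀ i, y i = -1 → ∀ j, j ≠ i → y j = 1) :
    -1 ≤ ∑ i, x i * y i := by
  by_cases hX : ∃ i, x i = -1
  · obtain ⟨i₀, hi₀⟩ := hX
    have hxj := hx i₀ hi₀
    by_cases hY : ∃ i, y i = -1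
    · obtain ⟨i₁, hi₁⟩ := hY
      have hyj := hy i₁ hi₁
      by_cases heq : i₁ = i₀
      · subst heq
        -- all terms are ≥ 0 except possibly none: x i₀ y i₀ = 1, others 1·1
        have hterm : ∀ i, 0 ≤ x i * y i := by
          intro i
          by_cases h : i = i₁
          · subst h; rw [hi₀, hi₁]; norm_num
          · rw [hxj i h, hyj i h]; norm_num
        have := Finset.sum_nonneg fun i (_ : i ∈ (univ : Finset γ)) => hterm i
        linarith
      · -- x = (-1 at i₀, 1 elsewhere), y = (-1 at i₁, 1 elsewhere): the sum is `#γ - 4 ≥ -1`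
        have hterm : ∀ i, x i * y i = 1 - 2 * (if i = i₀ then 1 else 0) - 2 * (if i = i₁ then 1 else 0) := by
          intro i
          by_cases h0 : i = i₀
          · subst h0
            rw [if_pos rfl, if_neg (Ne.symm heq), hi₀, hyj _ (Ne.symm heq)]; norm_num
          · by_cases h1 : i = i₁
            · subst h1
              rw [if_neg h0, if_pos rfl, hi₁, hxj _ h0]; norm_num
            · rw [if_neg h0, if_neg h1, hxj _ h0, hyj _ h1]; norm_num
        rw [Finset.sum_congr rfl (fun i _ => hterm i)]
        simp only [Finset.sum_sub_distrib, Finset.sum_const, Finset.card_univ, ← Finset.mul_sum, Finset.sum_ite_eq', Finset.mem_univ,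
          if_true, nsmul_eq_mul, mul_one]
        have : (3 : ℤ) ≤ (Fintype.card γ : ℤ) := by exact_mod_cast hγ
        linarith
    · -- y ≥ 0 everywhere
      have hyp : ∀ i, 0 ≤ y i := by
        intro i
        rcases hy0 i with h | h | h
        · exact absurd ⟨i, h⟩ hY
        · rw [h]
        · rw [h]; norm_num
      rw [← Finset.add_sum_erase _ _ (mem_univ i₀)]
      have h1 : -1 ≤ x i₀ * y i₀ := by
        rw [hi₀]
        rcases hy0 i₀ with h | h | h <;> rw [h] <;> norm_num
      have h2 : 0 ≤ ∑ j ∈ univ.erase i₀, x j * y j := by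
        refine Finset.sum_nonneg fun j hj => ?_
        rw [hxj j (ne_of_mem_erase hj), one_mul]
        exact hyp j
      linarith
  · have hxp : ∀ i, 0 ≤ x i := by
      intro i
      rcases hx0 i with h | h | h
      · exact absurd ⟨i, h⟩ hX
      · rw [h]
      · rw [h]; norm_num
    by_cases hY : ∃ i, y i = -1
    · obtain ⟨i₁, hi₁⟩ := hY
      have hyj := hy i₁ hi₁
      rw [← Finset.add_sum_erase _ _ (mem_univ i₁)]
      have h1 : -1 ≤ x i₁ * y i₁ := by
        rw [hi₁]
        rcases hx0 i₁ with h | h | h <;> rw [h] <;> norm_num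
      have h2 : 0 ≤ ∑ j ∈ univ.erase i₁, x j * y j := by
        refine Finset.sum_nonneg fun j hj => ?_
        rw [hyj j (ne_of_mem_erase hj), mul_one]
        exact hxp j
      linarith
    · have hyp : ∀ i, 0 ≤ y i := by
        intro i
        rcases hy0 i with h | h | h
        · exact absurd ⟨i, h⟩ hY
        · rw [h]
        · rw [h]; norm_num
      have := Finset.sum_nonneg fun i (_ : i ∈ (univ : Finset γ)) => mul_nonneg (hxp i) (hyp i)
      linarith

/-! ### The co-atom family -/

/-- The CO-ATOM FAMILY `{univ} ∪ {univ.erase i | i}` = `{w | #wᶜ ≤ 1}` (the threshold up-set "at least n−1 of n"). [this work] -/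
def coatomFamily (γ : Type) [DecidableEq γ] [Fintype γ] : Finset (Finset γ) :=
  insert univ (univ.image fun i : γ => univ.erase i)

omit [DecidableEq β] [Fintype β] in
/-- Membership in the co-atom family. [this work] -/
theorem mem_coatomFamily {w : Finset γ} : w ∈ coatomFamily γ ↔ w = univ ∨ ∃ i, w = univ.erase i := by
  unfold coatomFamily
  rw [mem_insert, mem_image]
  simp only [mem_univ, true_and, eq_comm]

omit [DecidableEq β] [Fintype β] in
/-- The co-atom family is an up-set. [this work] -/
theorem isUpperSet_coatomFamily : IsUpperSet (coatomFamily γ : Set (Finset γ)) := by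
  intro w w' hww' hw
  rw [mem_coe, mem_coatomFamily] at hw ⊢
  rcases hw with rfl | ⟨i, rfl⟩
  · left; exact eq_univ_of_forall fun k => hww' (mem_univ k)
  · by_cases hi : i ∈ w'
    · left
      refine eq_univ_of_forall fun k => ?_
      by_cases hk : k = i
      · rw [hk]; exact hi
      · exact hww' (mem_erase.2 ⟨hk, mem_univ k⟩)
    · right
      refine ⟨i, ?_⟩
      refine Subset.antisymm (fun k hk => mem_erase.2 ⟨fun h => hi (h ▸ hk), mem_univ k⟩) hww'

/-! ### The correlation on the co-atom family -/

omit [DecidableEq β] [Fintype β] in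
/-- `Cor_Q` as a sum of the pair summand over `Q`. [this work] -/
theorem corP_eq_sum (Q A B : Finset (Finset γ)) : corP Q A B = ∑ w ∈ Q, sgnDiff A (refl A) w * sgnDiff B (refl B) w := by
  unfold corP
  rw [card_inter_inter_eq_sum_ibit, card_inter_inter_eq_sum_ibit, card_inter_inter_eq_sum_ibit, card_inter_inter_eq_sum_ibit,
    ← Finset.sum_add_distrib, ← Finset.sum_sub_distrib, ← Finset.sum_sub_distrib]
  refine Finset.sum_congr rfl fun w _ => ?_
  unfold sgnDiff ibit
  simp only [mem_refl]
  ring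

omit [DecidableEq β] [Fintype β] [DecidableEq γ] [Fintype γ] in
/-- An up-set containing `∅` is everything. [this work] -/
theorem mem_of_empty_mem {A : Finset (Finset γ)} (hA : IsUpperSet (A : Set (Finset γ))) (h0 : ∅ ∈ A) (w : Finset γ) : w ∈ A :=
  hA (empty_subset w) h0

omit [DecidableEq β] [Fintype β] [DecidableEq γ] in
/-- A nonempty up-set contains `univ`. [this work] -/
theorem univ_mem_of_mem {A : Finset (Finset γ)} (hA : IsUpperSet (A : Set (Finset γ))) {w : Finset γ} (h : w ∈ A) : univ ∈ A :=
  hA (subset_univ w) h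

omit [DecidableEq β] [Fintype β] in
/-- The sign `x_i = [univ.erase i ∈ A] − [{i} ∈ A]` of an up-set at a co-atom: if `x_i = −1` then `x_j = 1` for all `j ≠ i`. [this work] -/
theorem sgnDiff_coatom_structure {A : Finset (Finset γ)} (hA : IsUpperSet (A : Set (Finset γ))) (i : γ)
    (hi : sgnDiff A (refl A) (univ.erase i) = -1) (j : γ) (hj : j ≠ i) : sgnDiff A (refl A) (univ.erase j) = 1 := by
  unfold sgnDiff at hi ⊢
  simp only [mem_refl] at hi ⊢
  -- from `hi`: `univ.erase i ∉ A` and `(univ.erase i)ᶜ ∈ A`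
  have h1 : (univ.erase i)ᶜ ∈ A := by
    by_contra h
    rw [if_neg h] at hi
    split_ifs at hi <;> omega
  have h2 : univ.erase i ∉ A := by
    intro h
    rw [if_pos h, if_pos h1] at hi
    omega
  -- `(univ.erase i)ᶜ = {i} ⊆ univ.erase j`, and `(univ.erase j)ᶜ = {j} ⊆ univ.erase i`
  have hsub : ∀ k l : γ, l ≠ k → (univ.erase k)ᶜ ⊆ univ.erase l := by
    intro k l hlk m hm
    rw [mem_compl, mem_erase, not_and_or, not_not] at hm
    rcases hm with hm | hm
    · rw [hm]; exact mem_erase.2 ⟨hlk.symm, mem_univ k⟩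
    · exact absurd (mem_univ m) hm
  have h3 : univ.erase j ∈ A := hA (hsub i j hj) h1
  have h4 : (univ.erase j)ᶜ ∉ A := fun h => h2 (hA (hsub j i hj.symm) h)
  rw [if_pos h3, if_neg h4]
  norm_num

omit [DecidableEq β] [Fintype β] [Fintype γ] in
/-- Values of the sign are in `{−1,0,1}`. [this work] -/
theorem sgnDiff_trichotomy (A A' : Finset (Finset γ)) (w : Finset γ) : sgnDiff A A' w = -1 ∨ sgnDiff A A' w = 0 ∨ sgnDiff A A' w = 1 := by
  unfold sgnDiff; split_ifs <;> simp

omit [DecidableEq β] [Fintype β] in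
/-- **`Cor_P ≥ 0` for the co-atom family**, `#γ ≥ 3`, all up-sets `A, B`. [this work] -/
theorem corP_coatomFamily_nonneg (hγ : 3 ≤ Fintype.card γ) {A B : Finset (Finset γ)}
    (hA : IsUpperSet (A : Set (Finset γ))) (hB : IsUpperSet (B : Set (Finset γ))) : 0 ≤ corP (coatomFamily γ) A B := by
  rw [corP_eq_sum]
  unfold coatomFamily
  have hnot : (univ : Finset γ) ∉ univ.image (fun i : γ => univ.erase i) := by
    rw [mem_image]
    rintro ⟨i, -, h⟩
    have := mem_univ i
    rw [← h] at this
    exact (notMem_erase i univ) this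
  rw [Finset.sum_insert hnot, Finset.sum_image (fun i _ j _ h => (Finset.erase_inj (univ : Finset γ) (mem_univ i)).1 h)]
  -- degenerate cases: `∅ ∈ A` (then `A` is everything) or `A = ∅` make every `A`-sign vanish; same for `B`
  have hdeg : ∀ C : Finset (Finset γ), IsUpperSet (C : Set (Finset γ)) → (∅ ∈ C ∨ C = ∅) → ∀ w, sgnDiff C (refl C) w = 0 := by
    rintro C hC (h | h) w
    · unfold sgnDiff
      simp only [mem_refl]
      rw [if_pos (mem_of_empty_mem hC h w), if_pos (mem_of_empty_mem hC h wᶜ)]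
      norm_num
    · subst h
      unfold sgnDiff
      simp [mem_refl]
  by_cases hA0 : ∅ ∈ A ∨ A = ∅
  · simp only [hdeg A hA hA0, zero_mul, Finset.sum_const_zero, add_zero]
    exact le_refl _
  by_cases hB0 : ∅ ∈ B ∨ B = ∅
  · simp only [hdeg B hB hB0, mul_zero, Finset.sum_const_zero, add_zero]
    exact le_refl _
  rw [not_or] at hA0 hB0
  -- now `univ ∈ A`, `∅ ∉ A` (same for `B`): the top term is `1`
  have huA : univ ∈ A := by
    obtain ⟨w, hw⟩ := Finset.nonempty_iff_ne_empty.2 hA0.2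
    exact univ_mem_of_mem hA hw
  have huB : univ ∈ B := by
    obtain ⟨w, hw⟩ := Finset.nonempty_iff_ne_empty.2 hB0.2
    exact univ_mem_of_mem hB hw
  have h1 : sgnDiff A (refl A) univ * sgnDiff B (refl B) univ = 1 := by
    unfold sgnDiff
    simp only [mem_refl, compl_univ]
    rw [if_pos huA, if_neg hA0.1, if_pos huB, if_neg hB0.1]
    norm_num
  rw [h1]
  have hmain := sum_mul_ge_neg_one hγ (fun i => sgnDiff A (refl A) (univ.erase i)) (fun i => sgnDiff B (refl B) (univ.erase i))
    (fun i => sgnDiff_trichotomy _ _ _) (fun i => sgnDiff_trichotomy _ _ _)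
    (fun i hi j hj => sgnDiff_coatom_structure hA i hi j hj) (fun i hi j hj => sgnDiff_coatom_structure hB i hi j hj)
  linarith

/-- **`TriWIneq` for the co-atom family** (`P = {w | #wᶜ ≤ 1}`, fibre cubes of dimension `≥ 3`): for EVERY index cube and all monotone families of up-sets `F, G`,
`0 ≤ triW (coatomFamily γ) F G`.  (The constant sandwich certificate of `…TriWCorNonneg`.) [this work] -/
theorem triW_nonneg_coatomFamily (hγ : 3 ≤ Fintype.card γ) (F G : Finset β → Finset (Finset γ))
    (hF : ∀ x, IsUpperSet (F x : Set (Finset γ))) (hG : ∀ x, IsUpperSet (G x : Set (Finset γ)))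
    (hFm : Monotone F) (hGm : Monotone G) :
    0 ≤ triW (coatomFamily γ) F G :=
  triW_nonneg_of_corP_nonneg isUpperSet_coatomFamily (fun _ _ hA hB => corP_coatomFamily_nonneg hγ hA hB) F G hF hG hFm hGm

end FiveUpSet

end Summit.CriticalPhenomena.PercolationContinuityZ3.Theorems
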